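import Summits.QuantumFields.BalabanUV.T4Continuum.Support.RegionGaugeResolventTowerMonotone
import Summits.QuantumFields.BalabanUV.T4Continuum.Support.DirichletMonotoneScattered
import Summits.QuantumFields.BalabanUV.T4Continuum.Support.RegionGaugeScatteredBoxes
import Summits.QuantumFields.BalabanUV.T4Continuum.Support.DirichletCornerMassRates

/-!
# T⁴ programme, spine node NE2 (U1a), sub-row Δ1 «NE2⁰-Dirichlet» — THE RE-ENTRANT CLASS ENDs: the complement of a scattered family of
# boxes of blocks is LOCALLY MONOTONE, and King's compressed injected law of the faithful `Δ_a(Ω₀)` there (and on any locally monotone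
# union with W1) DISPLAYS ONLY the local leaf (L) and the corner-mass GROWTH LAW `τ_k ≤ A·n_k^σ`

NE2 formalisation swarm `b2b-balaban-t4-ne2-formalise-*`, LEAF PROVER 09 (gen 10), junction brick (journal `HOME/CLAIMS.log` 2026-08-21
l.23790 / l.24724; memo `t4/T4-EST-NE2-D1-CORNER.md`).  This lineage's W1 theorem with ONE level-uniform constant covers the complement
`T ∖ ⋃_t K_t` of any SCATTERED FAMILY of boxes of blocks (`RegionGaugeScatteredBoxes.sliceCoercive_lev_boxes`, gen 9: boxes
`K_t = Π_ν [lo^t_ν, lo^t_ν + len^t_ν)`, `1 ≤ len^t_ν`, `len^t_ν + 2 ≤ M_ν`, one-block collars pairwise disjoint, hypothesis `hsep`), while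
`RegionGaugeResolventTowerMonotone.hinjK_boxHole_of_local_of_cornerMass` (this seat) treated ONE box.  THIS FILE:
 * **`exists_KOff_of_near`**: a block at sup-distance `≤ 1` from a block of the box `K` is a block of its collar (an offset in `KOff`);
 * **`eq_of_near_boxBlocks`**: hence, under `hsep`, blocks of two boxes of the family at sup-distance `≤ 1` belong to the same box;
 * **`locallyMonotone_compl_boxes`**: so `T ∖ ⋃_t K_t` is LOCALLY MONOTONE (`DirichletMonotoneScattered`, each `K_t` a coordinate box by
   `isCoordBox_boxBlocks`) — leaf-08-g3's Besov two-level law, this seat's (K) `hK_monotone` and the corner-mass junction apply to it;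
 * **THE END `hinjK_boxes_of_local_of_cornerMass`**: King's compressed injected law of the faithful `Δ_a(Ω₀)` on `T ∖ ⋃_t K_t` with W1, (K),
   (B), (Bᵗ) and the budget algebra DISCHARGED — displayed remain the local leaf (L) and the corner-mass growth `τ_k` of the scalar region
   Dirichlet solution with its two rates (owner R42 (c): level-dependent constants with a displayed growth rate);
 * **THE GROWTH-LAW ENDs `hinjK_of_local_of_cornerGrowth_monotone_slice`, `hinjK_boxHole_of_local_of_cornerGrowth`,
   `hinjK_boxes_of_local_of_cornerGrowth`**: the two rate binders discharged by `DirichletCornerMassRates` — displayed remain (L) at the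
   rate `θ_σ = (L^{(1−σ)/2})⁻¹` and ONE growth law `τ_k ≤ A·n_k^σ` (`0 ≤ σ`; decay needs `σ < 1`; memo §3: trivial `σ = 2`, Rellich `σ = 1`,
   expected `σ = 2/3`), plus W1 on a general locally monotone union.

HONEST FRAMING (T4-DAG p. 1).  Bookkeeping over landed modules ([folklore]); model level (`U = 1`, ONE region, ONE averaging scale, finite
torus, operator norm); (L), the corner-mass growth and its rates DISPLAYED — nothing about them is proved here; `hinjK` ∕ W3 off boxes OPEN;
Δ1 NOT closed; NE2 (U1a) NOT proved; spine PROVED 0/9 unchanged; NOT [B9] (3.16)/(3.23)–(3.27)/(3.42)/(3.48) as printed; NOT infinite volume,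
NOT a mass gap, NOT the Clay problem.  HONEST DEPENDENCY: continuum YM on T⁴ ⇐ BetaPertH ∧ nine spine estimates (0/9 proved); BetaPertH ⇐ (D1)
∧ (D4) ∧ CAP+tail; G-an2-4 gates asym, D1 and NE2/3/4.  No `sorry`.
-/

noncomputable section

open scoped BigOperators ComplexConjugate Matrix Matrix.Norms.L2Operator
open Finset

namespace Summit.QuantumFields.BalabanUV.T4Continuum.RegionGaugeResolventTowerReentrant

open Literature.MathematicalPhysics.QuantumFieldTheory.Balaban1983to89.B5Prop11Plancherel (Tor fine)
open Literature.MathematicalPhysics.QuantumFieldTheory.Balaban1983to89.B5Prop11Lower (nsq)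
open Literature.MathematicalPhysics.QuantumFieldTheory.Balaban1983to89.B5G183RateUnitTower (lev)
open Summit.QuantumFields.BalabanUV.T4Continuum
open Summit.QuantumFields.BalabanUV.T4Continuum.ScalarAveragedPropagator (gammaPs)
open Summit.QuantumFields.BalabanUV.T4Continuum.ScalarAveragedCompression (sigma0)
open Summit.QuantumFields.BalabanUV.T4Continuum.SubtypeCompression (Coercive)
open Summit.QuantumFields.BalabanUV.T4Continuum.RegionScalarCompression (QOm GOm)
open Summit.QuantumFields.BalabanUV.T4Continuum.RegionGaugeSlice (SliceCoercive)
open Summit.QuantumFields.BalabanUV.T4Continuum.RegionGaugeFixedVector (curlR gradR avgR regionDeltaA)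
open Summit.QuantumFields.BalabanUV.T4Continuum.RegionGaugeResolventSplit (regionDeltaLoc)
open Summit.QuantumFields.BalabanUV.T4Continuum.DirichletSubregionTowerOf (JpR)
open Summit.QuantumFields.BalabanUV.T4Continuum.DirichletStarVectorTower (starP gamStar)
open Summit.QuantumFields.BalabanUV.T4Continuum.RegionGaugeResolventTowerRegion (C1reg)
open Summit.QuantumFields.BalabanUV.T4Continuum.RegionGaugeColumnsTwoLevel (LamH)
open Summit.QuantumFields.BalabanUV.T4Continuum.RegionGaugeColumnsRegion (CgaugeRsq LamH_nonneg)
open Summit.QuantumFields.BalabanUV.T4Continuum.DirichletCornerRegularity (cornerMass)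
open Summit.QuantumFields.BalabanUV.T4Continuum.DirichletBesovTwoLevel (besovConst)
open Summit.QuantumFields.BalabanUV.T4Continuum.DirichletMonotoneCutoff (LocallyMonotone)
open Summit.QuantumFields.BalabanUV.T4Continuum.DirichletMonotoneScattered (locallyMonotone_congr
  locallyMonotone_compl_finsetBoxFamily_of_sep)
open Summit.QuantumFields.BalabanUV.T4Continuum.RegionGaugeResolventTowerMonotone (isCoordBox_boxBlocks locallyMonotone_boxHole
  hinjK_of_local_of_cornerMass_monotone_slice)
open Summit.QuantumFields.BalabanUV.T4Continuum.DirichletCornerMassRates (sqrtL_inv_le_rateTheta hrate_of_growth hrateB_of_growth)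
open Summit.QuantumFields.BalabanUV.T4Continuum.RegionGaugeHoled (holedConst holedConst_pos)
open Summit.QuantumFields.BalabanUV.T4Continuum.RegionBoxCollarFold (cblkB KOff mem_KOff)
open Summit.QuantumFields.BalabanUV.T4Continuum.RegionBoxCollarLift (KIn mem_KIn KIn_subset_KOff)
open Summit.QuantumFields.BalabanUV.T4Continuum.RegionGaugeBoxHole (boxBlocks sliceCoercive_lev_boxHole)
open Summit.QuantumFields.BalabanUV.T4Continuum.RegionGaugeScatteredBoxes (boxesBlocks sliceCoercive_lev_boxes)
open Summit.QuantumFields.BalabanUV.Beta.GAN24.DirichletBoxTrace (blockReg)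
open Summit.QuantumFields.BalabanUV.Beta.GAN24.DirichletBoxCompression (solExt)
open Summit.QuantumFields.BalabanUV.Beta.GAN24.DirichletBoxTwoLevel (Lam Lam_nonneg)

variable {d : ℕ}

/-! ## §1 Blocks near a box are collar blocks; scattered boxes are sup-distance-2 apart -/

section Geometry

variable (M : Fin d → ℕ) [hM : ∀ μ, NeZero (M μ)]

omit hM in
/-- **a block at sup-distance `≤ 1` from a block of the box `K = boxBlocks M lo len` is a block of its one-block collar**: it is
`cblkB M lo k` for an offset `k ∈ KOff len` (`0 ≤ k_ν ≤ len_ν + 1`). [folklore] -/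
theorem exists_KOff_of_near {lo : Tor M} {len : Fin d → ℕ} {b b' : Tor M} (hb : b ∈ boxBlocks M lo len)
    (hn : ∀ μ, b' μ = b μ ∨ b' μ = b μ + 1 ∨ b' μ + 1 = b μ) : ∃ k ∈ KOff len, b' = cblkB M lo k := by
  classical
  obtain ⟨i, hi, rfl⟩ := Finset.mem_image.1 hb
  have hin := (mem_KIn len).1 hi
  have hc : ∀ ν, ∃ j : ℕ, j < len ν + 2 ∧ b' ν = lo ν - 1 + ((j : ℕ) : ZMod (M ν)) := fun ν => by
    have e : cblkB M lo i ν = lo ν - 1 + ((i ν : ℕ) : ZMod (M ν)) := rfl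
    obtain ⟨h1, h2⟩ := hin ν
    rcases hn ν with h | h | h
    · exact ⟨i ν, by omega, by rw [h, e]⟩
    · exact ⟨i ν + 1, by omega, by rw [h, e, Nat.cast_succ, add_assoc]⟩
    · refine ⟨i ν - 1, by omega, ?_⟩
      rw [Nat.cast_pred h1, ← add_sub_assoc, ← e, ← h, add_sub_cancel_right]
  choose j hj hj' using hc
  exact ⟨j, (mem_KOff len).2 hj, funext hj'⟩

omit hM in
/-- **UNDER DISJOINT COLLARS, BLOCKS OF TWO BOXES OF THE FAMILY AT SUP-DISTANCE `≤ 1` BELONG TO THE SAME BOX**. [folklore] -/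
theorem eq_of_near_boxBlocks (T : Finset (Tor M × (Fin d → ℕ)))
    (hsep : ∀ t ∈ T, ∀ t' ∈ T, t ≠ t' → ∀ k ∈ KOff t.2, ∀ k' ∈ KOff t'.2, cblkB M t.1 k ≠ cblkB M t'.1 k')
    {t t' : Tor M × (Fin d → ℕ)} (ht : t ∈ T) (ht' : t' ∈ T) {b b' : Tor M} (hb : b ∈ boxBlocks M t.1 t.2)
    (hb' : b' ∈ boxBlocks M t'.1 t'.2) (hn : ∀ μ, b' μ = b μ ∨ b' μ = b μ + 1 ∨ b' μ + 1 = b μ) : t = t' := by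
  classical
  by_contra hne
  obtain ⟨k, hk, hkb⟩ := exists_KOff_of_near M hb hn
  obtain ⟨k', hk', hkb'⟩ := Finset.mem_image.1 hb'
  exact hsep t ht t' ht' hne k hk k' (KIn_subset_KOff t'.2 hk') (hkb.symm.trans hkb'.symm)

/-- **THE COMPLEMENT `T ∖ ⋃_t K_t` OF A SCATTERED FAMILY OF BOXES OF BLOCKS IS LOCALLY MONOTONE** (collars pairwise disjoint).
[folklore] -/
theorem locallyMonotone_compl_boxes (T : Finset (Tor M × (Fin d → ℕ)))
    (hsep : ∀ t ∈ T, ∀ t' ∈ T, t ≠ t' → ∀ k ∈ KOff t.2, ∀ k' ∈ KOff t'.2, cblkB M t.1 k ≠ cblkB M t'.1 k') :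
    LocallyMonotone M (fun y : Tor M => y ∉ boxesBlocks M T) := by
  have h := locallyMonotone_compl_finsetBoxFamily_of_sep M T (fun t b => b ∈ boxBlocks M t.1 t.2)
    (fun t _ => isCoordBox_boxBlocks M t.1 t.2) fun t ht t' ht' b b' hb hb' hn => eq_of_near_boxBlocks M T hsep ht ht' hb hb' hn
  refine locallyMonotone_congr M (fun b => ?_) h
  simp only [boxesBlocks, Finset.mem_biUnion, not_exists, not_and]

end Geometry

/-! ## §2 The END on the complement of a scattered family of boxes -/

section Boxes

variable (L : ℕ) [NeZero L] (M : Fin d → ℕ) [hM : ∀ μ, NeZero (M μ)] (T : Finset (Tor M × (Fin d → ℕ))) (a a' : ℝ)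

/-- **THE END — KING's COMPRESSED INJECTED LAW OF THE FAITHFUL `Δ_a(Ω₀)` ON THE COMPLEMENT OF A SCATTERED FAMILY OF BOXES OF BLOCKS**
(`1 ≤ len^t_ν`, `len^t_ν + 2 ≤ M_ν`, collars pairwise disjoint, `2 ≤ L`, `1 ≤ d`, `0 < a`, `0 < a′`, `θ ≥ (√L)⁻¹`): W1 (gen 9's
`sliceCoercive_lev_boxes`, constant `holedConst d a a′`), (K) (p243206, via `locallyMonotone_compl_boxes`), (B) and (Bᵗ) (leaf-05-g9 /
leaf-06-g7 modulo budgets, budgets from the corner mass p243392) are THEOREMS; DISPLAYED remain the local leaf (L) and the corner-mass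
growth `τ_k` of the scalar region Dirichlet solution with its two rates. [folklore] -/
theorem hinjK_boxes_of_local_of_cornerMass (hT : ∀ t ∈ T, (∀ ν, 1 ≤ t.2 ν) ∧ ∀ ν, t.2 ν + 2 ≤ M ν)
    (hsep : ∀ t ∈ T, ∀ t' ∈ T, t ≠ t' → ∀ k ∈ KOff t.2, ∀ k' ∈ KOff t'.2, cblkB M t.1 k ≠ cblkB M t'.1 k') (hL : 2 ≤ L) (hd : 1 ≤ d)
    (ha : 0 < a) (ha' : 0 < a') {τ : ℕ → ℝ} (hτ0 : ∀ k, 0 ≤ τ k)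
    (hτ : ∀ (k : ℕ) (f : {x // blockReg (lev L k) M (fun y : Tor M => y ∉ boxesBlocks M T) x} → ℂ),
      ((lev L k : ℕ) : ℝ) ^ 4 * cornerMass (univ.filter (blockReg (lev L k) M (fun y : Tor M => y ∉ boxesBlocks M T)))
          (solExt (lev L k) M a' (blockReg (lev L k) M (fun y : Tor M => y ∉ boxesBlocks M T)) f) ≤ τ k * nsq f)
    {θ CH CB Cl : ℝ} (hθ : (Real.sqrt (L : ℝ))⁻¹ ≤ θ) (hCB : 0 ≤ CB)
    (hrate : ∀ k, Real.sqrt (2 * (Lam d a' + 2 * ((d : ℝ) - 1) * τ k) / ((lev L k : ℕ) : ℝ)) ≤ CH * θ ^ k)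
    (hrateB : ∀ k, Real.sqrt (CgaugeRsq d L a' (Lam d a' + 2 * ((d : ℝ) - 1) * τ k) (LamH d a' + 2 * ((d : ℝ) - 1) * τ k))
      * (Real.sqrt ((lev L k : ℕ) : ℝ))⁻¹ ≤ CB * θ ^ k)
    (hloc : ∀ k, ‖(regionDeltaLoc (lev L (k + 1)) M a (fun y : Tor M => y ∉ boxesBlocks M T))⁻¹
          * JpR L M (starP L M (fun y : Tor M => y ∉ boxesBlocks M T)) k
        - JpR L M (starP L M (fun y : Tor M => y ∉ boxesBlocks M T)) k
          * (regionDeltaLoc (lev L k) M a (fun y : Tor M => y ∉ boxesBlocks M T))⁻¹‖ ≤ Cl * θ ^ k) (k : ℕ) :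
    ‖(regionDeltaA (lev L (k + 1)) M a a' (fun y : Tor M => y ∉ boxesBlocks M T))⁻¹
          * JpR L M (starP L M (fun y : Tor M => y ∉ boxesBlocks M T)) k
        - JpR L M (starP L M (fun y : Tor M => y ∉ boxesBlocks M T)) k
          * (regionDeltaA (lev L k) M a a' (fun y : Tor M => y ∉ boxesBlocks M T))⁻¹‖
      ≤ C1reg d a' (gamStar d a' (holedConst d a a')) Cl CB (CB + (1 - (L : ℝ)⁻¹) * CH)
          (((sigma0 d a') ^ 2)⁻¹ * ((sigma0 d a') ^ 2)⁻¹ * (2 * (gammaPs d a')⁻¹ * (besovConst d a' 6 48 * Real.sqrt (L : ℝ))))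
        * θ ^ k :=
  hinjK_of_local_of_cornerMass_monotone_slice L M (fun y : Tor M => y ∉ boxesBlocks M T) a a' (locallyMonotone_compl_boxes M T hsep)
    hL hd ha' (holedConst_pos (a := a) (a' := a') ha ha') (sliceCoercive_lev_boxes M T a a' L hT hsep ha ha') hτ0 hτ hθ hCB hrate hrateB
    hloc k

end Boxes


/-! ## §3 The growth-law ENDs: the two rate binders discharged, displayed `(A, σ)` and (L) at `θ_σ = (L^{(1−σ)/2})⁻¹` -/

section Growth

variable (L : ℕ) [NeZero L] (M : Fin d → ℕ) [hM : ∀ μ, NeZero (M μ)] (S : Tor M → Prop) [DecidablePred S] (a a' : ℝ)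

/-- **KING's COMPRESSED INJECTED LAW OF `Δ_a(Ω₀)` ON A LOCALLY MONOTONE UNION FROM W1, (L) AND THE CORNER-MASS GROWTH LAW**
(`2 ≤ L`, `1 ≤ d`, `0 < a′`, `0 ≤ A`, `0 ≤ σ`): displayed are W1 in slice form (`c`), the corner-mass bound `hτ` with its growth law
`τ_k ≤ A·n_k^σ`, and (L) at the rate `θ_σ`; (K), (B), (Bᵗ), the budget algebra AND the two rate binders are theorems. [folklore] -/
theorem hinjK_of_local_of_cornerGrowth_monotone_slice (hS : LocallyMonotone M S) (hL : 2 ≤ L) (hd : 1 ≤ d) (ha' : 0 < a')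
    {c : ℝ} (hc : 0 < c)
    (hS1 : ∀ k, SliceCoercive (curlR (lev L k) M S) (gradR (lev L k) M S) (GOm (lev L k) M a' S) (QOm (lev L k) M S)
      (avgR (lev L k) M S) (a * ((lev L k : ℕ) : ℝ) ^ d) c)
    {τ : ℕ → ℝ} (hτ0 : ∀ k, 0 ≤ τ k)
    (hτ : ∀ (k : ℕ) (f : {x // blockReg (lev L k) M S x} → ℂ),
      ((lev L k : ℕ) : ℝ) ^ 4 * cornerMass (univ.filter (blockReg (lev L k) M S)) (solExt (lev L k) M a' (blockReg (lev L k) M S) f)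
        ≤ τ k * nsq f)
    {A σ : ℝ} (hA : 0 ≤ A) (hσ : 0 ≤ σ) (hgr : ∀ k, τ k ≤ A * ((lev L k : ℕ) : ℝ) ^ σ) {Cl : ℝ}
    (hloc : ∀ k, ‖(regionDeltaLoc (lev L (k + 1)) M a S)⁻¹ * JpR L M (starP L M S) k
        - JpR L M (starP L M S) k * (regionDeltaLoc (lev L k) M a S)⁻¹‖ ≤ Cl * (((L : ℝ) ^ ((1 - σ) / 2))⁻¹) ^ k) (k : ℕ) :
    ‖(regionDeltaA (lev L (k + 1)) M a a' S)⁻¹ * JpR L M (starP L M S) k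
        - JpR L M (starP L M S) k * (regionDeltaA (lev L k) M a a' S)⁻¹‖
      ≤ C1reg d a' (gamStar d a' c) Cl
          (Real.sqrt (CgaugeRsq d L a' (Lam d a' + 2 * ((d : ℝ) - 1) * A) (LamH d a' + 2 * ((d : ℝ) - 1) * A)))
          (Real.sqrt (CgaugeRsq d L a' (Lam d a' + 2 * ((d : ℝ) - 1) * A) (LamH d a' + 2 * ((d : ℝ) - 1) * A))
            + (1 - (L : ℝ)⁻¹) * Real.sqrt (2 * (Lam d a' + 2 * ((d : ℝ) - 1) * A)))
          (((sigma0 d a') ^ 2)⁻¹ * ((sigma0 d a') ^ 2)⁻¹ * (2 * (gammaPs d a')⁻¹ * (besovConst d a' 6 48 * Real.sqrt (L : ℝ))))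
        * (((L : ℝ) ^ ((1 - σ) / 2))⁻¹) ^ k := by
  have h1 : (1 : ℝ) ≤ (d : ℝ) := by exact_mod_cast hd
  have h2 : 0 ≤ 2 * ((d : ℝ) - 1) := by linarith
  exact hinjK_of_local_of_cornerMass_monotone_slice L M S a a' hS hL hd ha' hc hS1 hτ0 hτ
    (sqrtL_inv_le_rateTheta L (le_trans (by norm_num) hL) hσ) (Real.sqrt_nonneg _)
    (hrate_of_growth L (Lam_nonneg a') h2 hA hσ hgr) (hrateB_of_growth L a' (Lam_nonneg a') (LamH_nonneg a') h2 hA hσ hgr) hloc k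

end Growth

section GrowthBoxHole

variable (L : ℕ) [NeZero L] (M : Fin d → ℕ) [hM : ∀ μ, NeZero (M μ)] (lo : Tor M) (len : Fin d → ℕ) (a a' : ℝ)

/-- **THE GROWTH-LAW END ON THE TORUS MINUS A BOX OF BLOCKS** (`1 ≤ len_ν`, `len_ν + 2 ≤ M_ν`, `2 ≤ L`, `1 ≤ d`, `0 < a`, `0 < a′`,
`0 ≤ A`, `0 ≤ σ`): W1, (K), (B), (Bᵗ), the budget algebra and the rate binders are THEOREMS; displayed remain the corner-mass bound with its
growth law `τ_k ≤ A·n_k^σ` and (L) at `θ_σ`. [folklore] -/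
theorem hinjK_boxHole_of_local_of_cornerGrowth (hlen : ∀ ν, 1 ≤ len ν) (hM2 : ∀ ν, len ν + 2 ≤ M ν) (hL : 2 ≤ L) (hd : 1 ≤ d)
    (ha : 0 < a) (ha' : 0 < a') {τ : ℕ → ℝ} (hτ0 : ∀ k, 0 ≤ τ k)
    (hτ : ∀ (k : ℕ) (f : {x // blockReg (lev L k) M (fun y : Tor M => y ∉ boxBlocks M lo len) x} → ℂ),
      ((lev L k : ℕ) : ℝ) ^ 4 * cornerMass (univ.filter (blockReg (lev L k) M (fun y : Tor M => y ∉ boxBlocks M lo len)))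
          (solExt (lev L k) M a' (blockReg (lev L k) M (fun y : Tor M => y ∉ boxBlocks M lo len)) f) ≤ τ k * nsq f)
    {A σ : ℝ} (hA : 0 ≤ A) (hσ : 0 ≤ σ) (hgr : ∀ k, τ k ≤ A * ((lev L k : ℕ) : ℝ) ^ σ) {Cl : ℝ}
    (hloc : ∀ k, ‖(regionDeltaLoc (lev L (k + 1)) M a (fun y : Tor M => y ∉ boxBlocks M lo len))⁻¹
          * JpR L M (starP L M (fun y : Tor M => y ∉ boxBlocks M lo len)) k
        - JpR L M (starP L M (fun y : Tor M => y ∉ boxBlocks M lo len)) k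
          * (regionDeltaLoc (lev L k) M a (fun y : Tor M => y ∉ boxBlocks M lo len))⁻¹‖ ≤ Cl * (((L : ℝ) ^ ((1 - σ) / 2))⁻¹) ^ k)
    (k : ℕ) :
    ‖(regionDeltaA (lev L (k + 1)) M a a' (fun y : Tor M => y ∉ boxBlocks M lo len))⁻¹
          * JpR L M (starP L M (fun y : Tor M => y ∉ boxBlocks M lo len)) k
        - JpR L M (starP L M (fun y : Tor M => y ∉ boxBlocks M lo len)) k
          * (regionDeltaA (lev L k) M a a' (fun y : Tor M => y ∉ boxBlocks M lo len))⁻¹‖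
      ≤ C1reg d a' (gamStar d a' (holedConst d a a')) Cl
          (Real.sqrt (CgaugeRsq d L a' (Lam d a' + 2 * ((d : ℝ) - 1) * A) (LamH d a' + 2 * ((d : ℝ) - 1) * A)))
          (Real.sqrt (CgaugeRsq d L a' (Lam d a' + 2 * ((d : ℝ) - 1) * A) (LamH d a' + 2 * ((d : ℝ) - 1) * A))
            + (1 - (L : ℝ)⁻¹) * Real.sqrt (2 * (Lam d a' + 2 * ((d : ℝ) - 1) * A)))
          (((sigma0 d a') ^ 2)⁻¹ * ((sigma0 d a') ^ 2)⁻¹ * (2 * (gammaPs d a')⁻¹ * (besovConst d a' 6 48 * Real.sqrt (L : ℝ))))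
        * (((L : ℝ) ^ ((1 - σ) / 2))⁻¹) ^ k :=
  hinjK_of_local_of_cornerGrowth_monotone_slice L M (fun y : Tor M => y ∉ boxBlocks M lo len) a a' (locallyMonotone_boxHole M lo len)
    hL hd ha' (holedConst_pos (a := a) (a' := a') ha ha') (sliceCoercive_lev_boxHole M lo len a a' L hlen hM2 ha ha') hτ0 hτ hA hσ hgr
    hloc k

end GrowthBoxHole

section GrowthBoxes

variable (L : ℕ) [NeZero L] (M : Fin d → ℕ) [hM : ∀ μ, NeZero (M μ)] (T : Finset (Tor M × (Fin d → ℕ))) (a a' : ℝ)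

/-- **THE GROWTH-LAW END ON THE COMPLEMENT OF A SCATTERED FAMILY OF BOXES OF BLOCKS** (collars pairwise disjoint; `2 ≤ L`, `1 ≤ d`,
`0 < a`, `0 < a′`, `0 ≤ A`, `0 ≤ σ`): displayed remain the corner-mass bound with its growth law and (L) at `θ_σ`. [folklore] -/
theorem hinjK_boxes_of_local_of_cornerGrowth (hT : ∀ t ∈ T, (∀ ν, 1 ≤ t.2 ν) ∧ ∀ ν, t.2 ν + 2 ≤ M ν)
    (hsep : ∀ t ∈ T, ∀ t' ∈ T, t ≠ t' → ∀ k ∈ KOff t.2, ∀ k' ∈ KOff t'.2, cblkB M t.1 k ≠ cblkB M t'.1 k') (hL : 2 ≤ L) (hd : 1 ≤ d)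
    (ha : 0 < a) (ha' : 0 < a') {τ : ℕ → ℝ} (hτ0 : ∀ k, 0 ≤ τ k)
    (hτ : ∀ (k : ℕ) (f : {x // blockReg (lev L k) M (fun y : Tor M => y ∉ boxesBlocks M T) x} → ℂ),
      ((lev L k : ℕ) : ℝ) ^ 4 * cornerMass (univ.filter (blockReg (lev L k) M (fun y : Tor M => y ∉ boxesBlocks M T)))
          (solExt (lev L k) M a' (blockReg (lev L k) M (fun y : Tor M => y ∉ boxesBlocks M T)) f) ≤ τ k * nsq f)
    {A σ : ℝ} (hA : 0 ≤ A) (hσ : 0 ≤ σ) (hgr : ∀ k, τ k ≤ A * ((lev L k : ℕ) : ℝ) ^ σ) {Cl : ℝ}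
    (hloc : ∀ k, ‖(regionDeltaLoc (lev L (k + 1)) M a (fun y : Tor M => y ∉ boxesBlocks M T))⁻¹
          * JpR L M (starP L M (fun y : Tor M => y ∉ boxesBlocks M T)) k
        - JpR L M (starP L M (fun y : Tor M => y ∉ boxesBlocks M T)) k
          * (regionDeltaLoc (lev L k) M a (fun y : Tor M => y ∉ boxesBlocks M T))⁻¹‖ ≤ Cl * (((L : ℝ) ^ ((1 - σ) / 2))⁻¹) ^ k)
    (k : ℕ) :
    ‖(regionDeltaA (lev L (k + 1)) M a a' (fun y : Tor M => y ∉ boxesBlocks M T))⁻¹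
          * JpR L M (starP L M (fun y : Tor M => y ∉ boxesBlocks M T)) k
        - JpR L M (starP L M (fun y : Tor M => y ∉ boxesBlocks M T)) k
          * (regionDeltaA (lev L k) M a a' (fun y : Tor M => y ∉ boxesBlocks M T))⁻¹‖
      ≤ C1reg d a' (gamStar d a' (holedConst d a a')) Cl
          (Real.sqrt (CgaugeRsq d L a' (Lam d a' + 2 * ((d : ℝ) - 1) * A) (LamH d a' + 2 * ((d : ℝ) - 1) * A)))
          (Real.sqrt (CgaugeRsq d L a' (Lam d a' + 2 * ((d : ℝ) - 1) * A) (LamH d a' + 2 * ((d : ℝ) - 1) * A))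
            + (1 - (L : ℝ)⁻¹) * Real.sqrt (2 * (Lam d a' + 2 * ((d : ℝ) - 1) * A)))
          (((sigma0 d a') ^ 2)⁻¹ * ((sigma0 d a') ^ 2)⁻¹ * (2 * (gammaPs d a')⁻¹ * (besovConst d a' 6 48 * Real.sqrt (L : ℝ))))
        * (((L : ℝ) ^ ((1 - σ) / 2))⁻¹) ^ k :=
  hinjK_of_local_of_cornerGrowth_monotone_slice L M (fun y : Tor M => y ∉ boxesBlocks M T) a a' (locallyMonotone_compl_boxes M T hsep)
    hL hd ha' (holedConst_pos (a := a) (a' := a') ha ha') (sliceCoercive_lev_boxes M T a a' L hT hsep ha ha') hτ0 hτ hA hσ hgr hloc k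

end GrowthBoxes

end Summit.QuantumFields.BalabanUV.T4Continuum.RegionGaugeResolventTowerReentrant

end
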